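import Mathlib
import Literature.NumberTheory.UniformDistribution.Invariances
import Summits.AtomisticToContinuum.Crystallization.Theorems.BraggSlacknessRigidityHcpDiffractionRigidityDenseCentresAux
import Summits.AtomisticToContinuum.Crystallization.Theorems.BraggSlacknessRigidityHcpDiffractionRigidityWindowsOfEssentialPeriodicityAux

/-!
# Weighted structure factors of separated sets: truncation, a modulated Gaussian identity and
# dual periodicity (stub `stub_essentialPeriodicityRat` of crux `HcpDiffractionRigidity`,
# item `stmt-AtomisticToContinuum-13166`, Aux file 1)

Spectral tool kit for the essential-periodicity stub (rational case). For a set `Λ ⊆ ℝ³` and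
non-negative weights `c` summable over `Λ`, the weighted structure factor
`S(ξ) = ∑'_{s ∈ Λ} c(s) e^{2πi⟨ξ,s⟩}` is bounded by `∑' c` and continuous; its truncations to the
finite windows `{|s| ≤ n}` of a separated `Λ` converge to it pointwise, and
`∫ g |S_n|² → ∫ g |S|²` for every integrable `g` (dominated convergence).

* `integral_gauss_cos_normSq_sum` — the modulated Gaussian quadratic-form identity for finite
  families: `∫ e^{-σ|ξ|²} cos(2π⟨ξ,z₀⟩) |∑ᵢ cᵢ e^{2πi⟨ξ,yᵢ⟩}|² dξ
  = ∑ᵢ∑ⱼ cᵢcⱼ (π/σ)^{3/2} e^{-π²|yᵢ - yⱼ - z₀|²/σ}` (expand the square and use the Gaussian Fourier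
  pairing `HcpRigidityDenseCentres.integral_gauss_phase`);
* `tsum_phase_add_eq`, `integral_comp_sub_eq` — exact periodicity of `|S|²` under every `m` with
  `⟨m, s⟩ ∈ ℤ` for all `s ∈ Λ`, and the resulting invariance `∫ g(ξ - m)|S(ξ)|² = ∫ g |S|²`.

All `[folklore]`.
-/

noncomputable section

namespace Summit.AtomisticToContinuum.Crystallization.Theorems

namespace HcpRigiditySpectral

open MeasureTheory Complex Filter Metric Set
open scoped BigOperators Real RealInnerProductSpace ComplexConjugate Topology
open Summit.AtomisticToContinuum.Crystallization.Theorems.HcpRigidityDenseCentres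
open Summit.AtomisticToContinuum.Crystallization.Theorems.HcpRigidityWindows

/-! ## Phases and weighted structure factors -/

/-- The norm of a weighted phase is the weight. [folklore] -/
theorem norm_weight_mul_phase {c : ℝ} (hc : 0 ≤ c) (ξ s : EuclideanSpace ℝ (Fin 3)) :
    ‖(c : ℂ) * cexp (2 * Real.pi * I * (⟪ξ, s⟫ : ℂ))‖ = c := by
  rw [norm_mul, Literature.NumberTheory.UniformDistribution.norm_cexp_two_pi_mul_ofReal, mul_one,
    Complex.norm_real, Real.norm_of_nonneg hc]

/-- Weighted phases with summable non-negative weights are summable. [folklore] -/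
theorem summable_weight_mul_phase {Λ : Set (EuclideanSpace ℝ (Fin 3))} {c : EuclideanSpace ℝ (Fin 3) → ℝ} (hc0 : ∀ z, 0 ≤ c z)
    (hcs : Summable fun s : Λ => c s) (ξ : EuclideanSpace ℝ (Fin 3)) :
    Summable fun s : Λ => (c s : ℂ) * cexp (2 * Real.pi * I * (⟪ξ, (s : EuclideanSpace ℝ (Fin 3))⟫ : ℂ)) :=
  Summable.of_norm_bounded hcs fun s => (norm_weight_mul_phase (hc0 _) ξ s).le

/-- A finite weighted structure factor is bounded by the sum of its weights. [folklore] -/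
theorem norm_sum_weight_mul_phase_le {Λ : Set (EuclideanSpace ℝ (Fin 3))} {c : EuclideanSpace ℝ (Fin 3) → ℝ} (hc0 : ∀ z, 0 ≤ c z)
    (T : Finset Λ) (ξ : EuclideanSpace ℝ (Fin 3)) :
    ‖∑ s ∈ T, (c s : ℂ) * cexp (2 * Real.pi * I * (⟪ξ, (s : EuclideanSpace ℝ (Fin 3))⟫ : ℂ))‖ ≤ ∑ s ∈ T, c s :=
  (norm_sum_le _ _).trans (le_of_eq (Finset.sum_congr rfl fun s _ => norm_weight_mul_phase (hc0 _) ξ s))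

/-- The weighted structure factor is bounded by the total weight. [folklore] -/
theorem norm_tsum_weight_mul_phase_le {Λ : Set (EuclideanSpace ℝ (Fin 3))} {c : EuclideanSpace ℝ (Fin 3) → ℝ} (hc0 : ∀ z, 0 ≤ c z)
    (hcs : Summable fun s : Λ => c s) (ξ : EuclideanSpace ℝ (Fin 3)) :
    ‖∑' s : Λ, (c s : ℂ) * cexp (2 * Real.pi * I * (⟪ξ, (s : EuclideanSpace ℝ (Fin 3))⟫ : ℂ))‖ ≤ ∑' s : Λ, c s := by
  have h : ∀ s : Λ, ‖(c s : ℂ) * cexp (2 * Real.pi * I * (⟪ξ, (s : EuclideanSpace ℝ (Fin 3))⟫ : ℂ))‖ = c s := fun s =>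
    norm_weight_mul_phase (hc0 _) ξ s
  have hs : Summable fun s : Λ => ‖(c s : ℂ) * cexp (2 * Real.pi * I * (⟪ξ, (s : EuclideanSpace ℝ (Fin 3))⟫ : ℂ))‖ := by
    simp_rw [h]; exact hcs
  refine (norm_tsum_le_tsum_norm hs).trans (le_of_eq (tsum_congr h))

/-- A finite partial sum of the weights is bounded by the total weight. [folklore] -/
theorem sum_le_tsum_weight {Λ : Set (EuclideanSpace ℝ (Fin 3))} {c : EuclideanSpace ℝ (Fin 3) → ℝ} (hc0 : ∀ z, 0 ≤ c z)
    (hcs : Summable fun s : Λ => c s) (T : Finset Λ) : ∑ s ∈ T, c s ≤ ∑' s : Λ, c s :=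
  hcs.sum_le_tsum T fun _ _ => hc0 _

/-- The weighted structure factor is continuous. [folklore] -/
theorem continuous_tsum_weight_mul_phase {Λ : Set (EuclideanSpace ℝ (Fin 3))} {c : EuclideanSpace ℝ (Fin 3) → ℝ} (hc0 : ∀ z, 0 ≤ c z)
    (hcs : Summable fun s : Λ => c s) :
    Continuous fun ξ : EuclideanSpace ℝ (Fin 3) => ∑' s : Λ, (c s : ℂ) * cexp (2 * Real.pi * I * (⟪ξ, (s : EuclideanSpace ℝ (Fin 3))⟫ : ℂ)) :=
  continuous_tsum (fun _ => by fun_prop) hcs fun s ξ => (norm_weight_mul_phase (hc0 _) ξ s).le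

/-! ## Truncation to the finite windows `{|s| ≤ n}` -/

/-- The finite windows `{s ∈ Λ : |s| ≤ n}` of a separated set exhaust it (`Finset`-`atTop`).
[folklore] -/
theorem tendsto_truncation {Λ : Set (EuclideanSpace ℝ (Fin 3))} {δ : ℝ} (hδ : 0 < δ)
    (hΛ : ∀ p ∈ Λ, ∀ q ∈ Λ, p ≠ q → δ ≤ dist p q) :
    Tendsto (fun n : ℕ => (finite_norm_le hδ hΛ (n : ℝ)).toFinset) atTop atTop := by
  refine tendsto_atTop_finset_of_monotone (fun m n hmn s hs => ?_) fun s => ?_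
  · simp only [Set.Finite.mem_toFinset, Set.mem_setOf_eq] at hs ⊢
    exact hs.trans (by exact_mod_cast hmn)
  · exact ⟨⌈‖(s : EuclideanSpace ℝ (Fin 3))‖⌉₊, by
      simp only [Set.Finite.mem_toFinset, Set.mem_setOf_eq]; exact Nat.le_ceil _⟩

/-- Sums over the finite windows converge to the sum over `Λ`. [folklore] -/
theorem tendsto_sum_truncation {F : Type*} [NormedAddCommGroup F] {Λ : Set (EuclideanSpace ℝ (Fin 3))} {δ : ℝ}
    (hδ : 0 < δ) (hΛ : ∀ p ∈ Λ, ∀ q ∈ Λ, p ≠ q → δ ≤ dist p q) {f : Λ → F} (hf : Summable f) :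
    Tendsto (fun n : ℕ => ∑ s ∈ (finite_norm_le hδ hΛ (n : ℝ)).toFinset, f s) atTop
      (𝓝 (∑' s : Λ, f s)) :=
  hf.hasSum.comp (tendsto_truncation hδ hΛ)

/-- **Truncated intensities converge.** For non-negative weights `c` summable over a separated
`Λ` and an integrable `g`, `∫ g |S_n|² → ∫ g |S|²`, where `S_n` is the structure factor of the
window `{|s| ≤ n}` (dominated convergence with the bound `(∑' c)²`). [folklore] -/
theorem tendsto_integral_truncation {Λ : Set (EuclideanSpace ℝ (Fin 3))} {δ : ℝ} (hδ : 0 < δ)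
    (hΛ : ∀ p ∈ Λ, ∀ q ∈ Λ, p ≠ q → δ ≤ dist p q) {c : EuclideanSpace ℝ (Fin 3) → ℝ} (hc0 : ∀ z, 0 ≤ c z)
    (hcs : Summable fun s : Λ => c s) {g : EuclideanSpace ℝ (Fin 3) → ℝ} (hg : Integrable g) :
    Tendsto (fun n : ℕ => ∫ ξ : EuclideanSpace ℝ (Fin 3), g ξ * ‖∑ s ∈ (finite_norm_le hδ hΛ (n : ℝ)).toFinset,
        (c s : ℂ) * cexp (2 * Real.pi * I * (⟪ξ, (s : EuclideanSpace ℝ (Fin 3))⟫ : ℂ))‖ ^ 2) atTop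
      (𝓝 (∫ ξ : EuclideanSpace ℝ (Fin 3), g ξ * ‖∑' s : Λ, (c s : ℂ) * cexp (2 * Real.pi * I * (⟪ξ, (s : EuclideanSpace ℝ (Fin 3))⟫ : ℂ))‖ ^ 2)) := by
  set W : ℝ := ∑' s : Λ, c s with hW
  refine tendsto_integral_of_dominated_convergence (fun ξ => ‖g ξ‖ * W ^ 2) (fun n => ?_)
    (hg.norm.mul_const _) (fun n => ae_of_all _ fun ξ => ?_) (ae_of_all _ fun ξ => ?_)
  · exact (hg.aestronglyMeasurable.mul (Continuous.aestronglyMeasurable (by fun_prop)))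
  · rw [norm_mul, Real.norm_of_nonneg (by positivity : (0 : ℝ) ≤ ‖_‖ ^ 2)]
    refine mul_le_mul_of_nonneg_left ?_ (norm_nonneg _)
    exact pow_le_pow_left₀ (norm_nonneg _) ((norm_sum_weight_mul_phase_le hc0 _ ξ).trans
      (sum_le_tsum_weight hc0 hcs _)) 2
  · exact ((tendsto_sum_truncation hδ hΛ (summable_weight_mul_phase hc0 hcs ξ)).norm.pow 2).const_mul
      (g ξ)

/-- `g |S|²` is integrable for every integrable `g`. [folklore] -/
theorem integrable_mul_normSq_tsum {Λ : Set (EuclideanSpace ℝ (Fin 3))} {c : EuclideanSpace ℝ (Fin 3) → ℝ} (hc0 : ∀ z, 0 ≤ c z)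
    (hcs : Summable fun s : Λ => c s) {g : EuclideanSpace ℝ (Fin 3) → ℝ} (hg : Integrable g) :
    Integrable fun ξ : EuclideanSpace ℝ (Fin 3) => g ξ *
      ‖∑' s : Λ, (c s : ℂ) * cexp (2 * Real.pi * I * (⟪ξ, (s : EuclideanSpace ℝ (Fin 3))⟫ : ℂ))‖ ^ 2 := by
  refine hg.mul_bdd (c := (∑' s : Λ, c s) ^ 2)
    ((continuous_tsum_weight_mul_phase hc0 hcs).norm.pow 2).aestronglyMeasurable
    (ae_of_all _ fun ξ => ?_)
  rw [Real.norm_of_nonneg (by positivity)]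
  exact pow_le_pow_left₀ (norm_nonneg _) (norm_tsum_weight_mul_phase_le hc0 hcs ξ) 2

/-! ## The modulated Gaussian quadratic-form identity -/

/-- One term of the expanded modulated square. [folklore] -/
theorem weight_phase_mul_conj_mul (ξ u v z₀ : EuclideanSpace ℝ (Fin 3)) (a b σ : ℝ) :
    (a : ℂ) * cexp (2 * Real.pi * I * (⟪ξ, u⟫ : ℂ)) *
        conj ((b : ℂ) * cexp (2 * Real.pi * I * (⟪ξ, v⟫ : ℂ))) *
        ((Real.exp (-σ * ‖ξ‖ ^ 2) : ℂ) * conj (cexp (2 * Real.pi * I * (⟪ξ, z₀⟫ : ℂ)))) =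
      ((a * b : ℝ) : ℂ) * ((Real.exp (-σ * ‖ξ‖ ^ 2) : ℂ) *
        (cexp (2 * Real.pi * I * (⟪ξ, u⟫ : ℂ)) * conj (cexp (2 * Real.pi * I * (⟪ξ, v + z₀⟫ : ℂ))))) := by
  have h : cexp (2 * Real.pi * I * (⟪ξ, v + z₀⟫ : ℂ)) =
      cexp (2 * Real.pi * I * (⟪ξ, v⟫ : ℂ)) * cexp (2 * Real.pi * I * (⟪ξ, z₀⟫ : ℂ)) := by
    rw [← Complex.exp_add, inner_add_right]; push_cast; ring_nf
  rw [h, map_mul, map_mul, Complex.conj_ofReal]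
  push_cast
  ring

/-- The real part of the modulated intensity density. [folklore] -/
theorem re_gauss_conj_phase_normSq (ξ z₀ : EuclideanSpace ℝ (Fin 3)) (e r : ℝ) :
    ((e : ℂ) * conj (cexp (2 * Real.pi * I * (⟪ξ, z₀⟫ : ℂ))) * (r : ℂ)).re =
      e * Real.cos (2 * Real.pi * ⟪ξ, z₀⟫) * r := by
  have h : conj (cexp (2 * Real.pi * I * (⟪ξ, z₀⟫ : ℂ))) =
      cexp (((-(2 * Real.pi * ⟪ξ, z₀⟫) : ℝ) : ℂ) * I) := by
    rw [← Complex.exp_conj]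
    congr 1
    simp only [map_mul, map_ofNat, Complex.conj_ofReal, Complex.conj_I]
    push_cast
    ring
  rw [h, show (e : ℂ) * cexp (((-(2 * Real.pi * ⟪ξ, z₀⟫) : ℝ) : ℂ) * I) * (r : ℂ) =
    ((e * r : ℝ) : ℂ) * cexp (((-(2 * Real.pi * ⟪ξ, z₀⟫) : ℝ) : ℂ) * I) by push_cast; ring,
    Complex.re_ofReal_mul, Complex.exp_ofReal_mul_I_re, Real.cos_neg]
  ring

/-- **Modulated Gaussian quadratic-form identity (finite families).** For real weights `c`,
points `y`, `σ > 0` and a modulation vector `z₀`,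
`∫ e^{-σ|ξ|²} cos(2π⟨ξ,z₀⟩) |∑ᵢ cᵢ e^{2πi⟨ξ,yᵢ⟩}|² dξ = ∑ᵢ∑ⱼ cᵢcⱼ (π/σ)^{3/2} e^{-π²|yᵢ-yⱼ-z₀|²/σ}`.
[folklore] -/
theorem integral_gauss_cos_normSq_sum {α : Type*} (T : Finset α) (c : α → ℝ) {σ : ℝ} (hσ : 0 < σ)
    (y : α → EuclideanSpace ℝ (Fin 3)) (z₀ : EuclideanSpace ℝ (Fin 3)) :
    ∫ ξ : EuclideanSpace ℝ (Fin 3), Real.exp (-σ * ‖ξ‖ ^ 2) * Real.cos (2 * Real.pi * ⟪ξ, z₀⟫) *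
        ‖∑ i ∈ T, (c i : ℂ) * cexp (2 * Real.pi * I * (⟪ξ, y i⟫ : ℂ))‖ ^ 2 =
      ∑ i ∈ T, ∑ j ∈ T, c i * c j * ((Real.pi / σ) ^ ((3 : ℝ) / 2) *
        Real.exp (-(Real.pi ^ 2 * ‖y i - y j - z₀‖ ^ 2 / σ))) := by
  set g : α → α → EuclideanSpace ℝ (Fin 3) → ℂ := fun i j ξ => ((c i * c j : ℝ) : ℂ) *
    ((Real.exp (-σ * ‖ξ‖ ^ 2) : ℂ) * (cexp (2 * Real.pi * I * (⟪ξ, y i⟫ : ℂ)) *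
      conj (cexp (2 * Real.pi * I * (⟪ξ, y j + z₀⟫ : ℂ))))) with hg
  have hgi : ∀ i j, Integrable (g i j) := fun i j =>
    (integrable_gauss_phase hσ (y i) (y j + z₀)).const_mul _
  -- the modulated intensity density is the double sum of the `g i j`
  have hexp : ∀ ξ : EuclideanSpace ℝ (Fin 3), (Real.exp (-σ * ‖ξ‖ ^ 2) : ℂ) * conj (cexp (2 * Real.pi * I * (⟪ξ, z₀⟫ : ℂ))) *
      (((‖∑ i ∈ T, (c i : ℂ) * cexp (2 * Real.pi * I * (⟪ξ, y i⟫ : ℂ))‖ ^ 2 : ℝ)) : ℂ) =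
      ∑ i ∈ T, ∑ j ∈ T, g i j ξ := by
    intro ξ
    rw [← Complex.normSq_eq_norm_sq, ← Complex.mul_conj, map_sum, Finset.sum_mul_sum, mul_comm,
      Finset.sum_mul]
    refine Finset.sum_congr rfl fun i _ => ?_
    rw [Finset.sum_mul]
    refine Finset.sum_congr rfl fun j _ => ?_
    rw [hg, weight_phase_mul_conj_mul]
  have hre : ∀ ξ : EuclideanSpace ℝ (Fin 3), Real.exp (-σ * ‖ξ‖ ^ 2) * Real.cos (2 * Real.pi * ⟪ξ, z₀⟫) *
      ‖∑ i ∈ T, (c i : ℂ) * cexp (2 * Real.pi * I * (⟪ξ, y i⟫ : ℂ))‖ ^ 2 =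
      RCLike.re (∑ i ∈ T, ∑ j ∈ T, g i j ξ) := by
    intro ξ
    rw [← hexp ξ]
    exact (re_gauss_conj_phase_normSq ξ z₀ (Real.exp (-σ * ‖ξ‖ ^ 2)) _).symm
  simp_rw [hre]
  rw [integral_re (integrable_finsetSum _ fun i _ => integrable_finsetSum _ fun j _ => hgi i j),
    integral_finsetSum _ fun i _ => integrable_finsetSum _ fun j _ => hgi i j]
  simp_rw [integral_finsetSum _ fun j _ => hgi _ j]
  simp only [hg, integral_const_mul, integral_gauss_phase hσ, RCLike.re_to_complex, Complex.re_sum]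
  refine Finset.sum_congr rfl fun i _ => Finset.sum_congr rfl fun j _ => ?_
  rw [← Complex.ofReal_mul, Complex.ofReal_re, show y i - (y j + z₀) = y i - y j - z₀ by abel]

/-! ## Dual periodicity -/

/-- **Exact periodicity.** If `⟨m, s⟩ ∈ ℤ` for every `s ∈ Λ`, the weighted structure factor of
`Λ` is `m`-periodic. [folklore] -/
theorem tsum_phase_add_eq {Λ : Set (EuclideanSpace ℝ (Fin 3))} (c : EuclideanSpace ℝ (Fin 3) → ℝ) {m : EuclideanSpace ℝ (Fin 3)} (hm : ∀ s ∈ Λ, ∃ n : ℤ, ⟪m, s⟫ = n)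
    (ξ : EuclideanSpace ℝ (Fin 3)) :
    ∑' s : Λ, (c s : ℂ) * cexp (2 * Real.pi * I * (⟪ξ + m, (s : EuclideanSpace ℝ (Fin 3))⟫ : ℂ)) =
      ∑' s : Λ, (c s : ℂ) * cexp (2 * Real.pi * I * (⟪ξ, (s : EuclideanSpace ℝ (Fin 3))⟫ : ℂ)) := by
  refine tsum_congr fun s => ?_
  obtain ⟨n, hn⟩ := hm s s.2
  rw [inner_add_left, hn]
  push_cast
  rw [mul_add, Complex.exp_add, show 2 * Real.pi * I * (n : ℂ) = n * (2 * Real.pi * I) by ring,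
    Complex.exp_int_mul_two_pi_mul_I, mul_one]

/-- **Translation invariance of the intensity pairing.** If `⟨m, s⟩ ∈ ℤ` for every `s ∈ Λ`, then
`∫ g(ξ - m) |S(ξ)|² dξ = ∫ g(ξ) |S(ξ)|² dξ`. [folklore] -/
theorem integral_comp_sub_eq {Λ : Set (EuclideanSpace ℝ (Fin 3))} (c : EuclideanSpace ℝ (Fin 3) → ℝ) {m : EuclideanSpace ℝ (Fin 3)} (hm : ∀ s ∈ Λ, ∃ n : ℤ, ⟪m, s⟫ = n)
    (g : EuclideanSpace ℝ (Fin 3) → ℝ) :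
    ∫ ξ : EuclideanSpace ℝ (Fin 3), g (ξ - m) * ‖∑' s : Λ, (c s : ℂ) * cexp (2 * Real.pi * I * (⟪ξ, (s : EuclideanSpace ℝ (Fin 3))⟫ : ℂ))‖ ^ 2 =
      ∫ ξ : EuclideanSpace ℝ (Fin 3), g ξ * ‖∑' s : Λ, (c s : ℂ) * cexp (2 * Real.pi * I * (⟪ξ, (s : EuclideanSpace ℝ (Fin 3))⟫ : ℂ))‖ ^ 2 := by
  rw [← integral_add_right_eq_self (fun ξ : EuclideanSpace ℝ (Fin 3) =>
    g (ξ - m) * ‖∑' s : Λ, (c s : ℂ) * cexp (2 * Real.pi * I * (⟪ξ, (s : EuclideanSpace ℝ (Fin 3))⟫ : ℂ))‖ ^ 2) m]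
  refine integral_congr_ae (ae_of_all _ fun ξ => ?_)
  simp only [add_sub_cancel_right, tsum_phase_add_eq c hm]

end HcpRigiditySpectral

/-- **Registered helper stub of `stub_essentialPeriodicityRat` (Aux file 1): the modulated
Gaussian quadratic-form identity.** For real weights `c`, points `y`, `σ > 0` and `z₀ ∈ ℝ³`,
`∫ e^{-σ|ξ|²} cos(2π⟨ξ,z₀⟩) |∑ᵢ cᵢ e^{2πi⟨ξ,yᵢ⟩}|² dξ = ∑ᵢ∑ⱼ cᵢcⱼ (π/σ)^{3/2} e^{-π²|yᵢ-yⱼ-z₀|²/σ}`.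
[folklore] -/
theorem stub_essentialPeriodicityRatGaussIdentity : ∀ (N : ℕ) (y : Fin N → EuclideanSpace ℝ (Fin 3)) (c : Fin N → ℝ) (σ : ℝ), 0 < σ → ∀ z₀ : EuclideanSpace ℝ (Fin 3), ∫ ξ : EuclideanSpace ℝ (Fin 3), Real.exp (-σ * ‖ξ‖ ^ 2) * Real.cos (2 * Real.pi * inner ℝ ξ z₀) * ‖∑ i : Fin N, (c i : ℂ) * Complex.exp (2 * Real.pi * Complex.I * (inner ℝ ξ (y i) : ℂ))‖ ^ 2 = ∑ i : Fin N, ∑ j : Fin N, c i * c j * ((Real.pi / σ) ^ ((3 : ℝ) / 2) * Real.exp (-(Real.pi ^ 2 * ‖y i - y j - z₀‖ ^ 2 / σ))) :=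
  fun _ y c _ hσ z₀ => HcpRigiditySpectral.integral_gauss_cos_normSq_sum Finset.univ c hσ y z₀

end Summit.AtomisticToContinuum.Crystallization.Theorems

end
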